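import Summits.Ventures.PercRepro.RankLevelSetHallLevelOne
import Summits.Ventures.PercRepro.Night2ShadowForm

/-!
# PercRepro — ONE STATEMENT OF RECORD: `LevelHallUpC025 ↔ ShadowC025Level` (night-1, gen 23)

Night-2's level-wise shadow form `ShadowC025Level` (Night2ShadowForm, gen 5: for `q < u < p`, every sub-family `𝒜`
of the bottom sets `Uq M p q` has at least `C(p+q,u)/C(p+q,p)·#𝒜` rank-`u` sets above it — finsets) and night-1's
`LevelHallUpC025` (RankLevelSetHallLevel: the same inequality in the C-044 vocabulary `cellMembers` / `upNbhd` — sets)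
are the SAME conjecture.  THIS FILE proves the equivalence, so that the tree carries one statement of record
(night-2's, the earlier one), and restates the first-level theorem `levelHallUp_first_of_ncard_eq` in night-2's
vocabulary: `ShadowHallLevel M p q (q+1) (C(p+q,q+1)/C(p+q,p))` for every finite matroid with `#gr M = p + q`,
`q + 2 ≤ p`.

* `coe_mem_cellMembers_of_mem_Uq`, `mem_Uq_of_coe_mem_cellMembers` — bottom sets ↔ members;
* `levelSlice_eq_image_shadowLevel` — the rank-`u` UP-neighbourhood of the coerced family is the coerced
  `shadowLevel` (for `q < u < p`);
* **`levelHallUp_iff_shadowC025Level`**;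
* **`shadowHallLevel_first_of_card_eq`** — the first level `u = q + 1` at the tight layer in night-2's vocabulary.
Axioms: standard.
-/

namespace PercRepro

open Set Matroid Finset ThmH PerFlat Shadow

variable {α : Type} [DecidableEq α] {M : Matroid α} [M.Finite]

/-- A bottom set of `Uq M p q` is a member of the cell `(p, q)`. -/
lemma coe_mem_cellMembers_of_mem_Uq {p q : ℕ} {B : Finset α} (hB : B ∈ Uq M p q) :
    (B : Set α) ∈ cellMembers M p q := by
  rw [mem_Uq] at hB
  obtain ⟨hBg, hq, hp⟩ := hB
  refine ⟨?_, hq, ?_⟩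
  · rw [← coe_gr M]
    exact Finset.coe_subset.2 hBg
  · rw [← coe_gr M, ← Finset.coe_sdiff]
    exact hp

/-- A finset of the ground set whose coercion is a member is a bottom set. -/
lemma mem_Uq_of_coe_mem_cellMembers {p q : ℕ} {B : Finset α} (hBg : B ⊆ gr M)
    (hB : (B : Set α) ∈ cellMembers M p q) : B ∈ Uq M p q := by
  rw [mem_Uq]
  obtain ⟨-, hq, hp⟩ := hB
  refine ⟨hBg, hq, ?_⟩
  rw [Finset.coe_sdiff, coe_gr M]
  exact hp

/-- The coerced family of a finset family of bottom sets, as a set family of members. -/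
lemma image_coe_subset_cellMembers {p q : ℕ} {𝒜 : Finset (Finset α)} (h𝒜 : 𝒜 ⊆ Uq M p q) :
    (fun B : Finset α => (B : Set α)) '' (𝒜 : Set (Finset α)) ⊆ cellMembers M p q := by
  rintro Z ⟨B, hB, rfl⟩
  exact coe_mem_cellMembers_of_mem_Uq (h𝒜 (Finset.mem_coe.1 hB))

/-- **The rank-`u` UP-neighbourhood of the coerced family is the coerced `shadowLevel`** (for `q < u < p`). -/
lemma levelSlice_eq_image_shadowLevel {p q u : ℕ} (hqu : q < u) (hup : u < p) (𝒜 : Finset (Finset α)) :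
    {S ∈ upNbhd M p q ((fun B : Finset α => (B : Set α)) '' (𝒜 : Set (Finset α))) | M.eRk S = (u : ℕ∞)} =
      (fun S : Finset α => (S : Set α)) '' ((shadowLevel M u 𝒜 : Finset (Finset α)) : Set (Finset α)) := by
  ext S
  constructor
  · rintro ⟨⟨hSE, -, -, Z, ⟨B, hB, rfl⟩, hBS⟩, hr⟩
    have hSfin : S.Finite := M.ground_finite.subset hSE
    refine ⟨hSfin.toFinset, ?_, hSfin.coe_toFinset⟩
    rw [Finset.mem_coe]
    unfold shadowLevel levelSet
    rw [Finset.mem_filter, Finset.mem_filter, Finset.mem_powerset]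
    refine ⟨⟨?_, ?_⟩, B, Finset.mem_coe.1 hB, ?_⟩
    · intro x hx
      rw [hSfin.mem_toFinset] at hx
      rw [← Finset.mem_coe, coe_gr M]
      exact hSE hx
    · rw [hSfin.coe_toFinset]
      exact hr
    · intro x hx
      rw [hSfin.mem_toFinset]
      exact hBS (Finset.mem_coe.2 hx)
  · rintro ⟨Sf, hSf, rfl⟩
    rw [Finset.mem_coe] at hSf
    unfold shadowLevel levelSet at hSf
    rw [Finset.mem_filter, Finset.mem_filter, Finset.mem_powerset] at hSf
    obtain ⟨⟨hSg, hr⟩, B, hB, hBS⟩ := hSf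
    refine ⟨⟨?_, ?_, ?_, (B : Set α), ⟨B, Finset.mem_coe.2 hB, rfl⟩, Finset.coe_subset.2 hBS⟩, hr⟩
    · rw [← coe_gr M]
      exact Finset.coe_subset.2 hSg
    · rw [hr]; exact_mod_cast hqu
    · rw [hr]; exact_mod_cast hup

omit [DecidableEq α] in
/-- The coerced family has the same cardinality. -/
lemma ncard_image_coe (𝒜 : Finset (Finset α)) :
    ((fun B : Finset α => (B : Set α)) '' (𝒜 : Set (Finset α))).ncard = 𝒜.card := by
  rw [Set.ncard_image_of_injective _ Finset.coe_injective, Set.ncard_coe_finset]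

/-- **The level-wise form of night-1 implies night-2's `ShadowC025Level`.** -/
theorem shadowC025Level_of_levelHallUp (h : LevelHallUpC025) : ShadowC025Level := by
  intro α _ M _ p q u hqu hup 𝒜 h𝒜
  have hpq : q + 2 ≤ p := by omega
  have hL := h M p q u hpq hqu hup ((fun B : Finset α => (B : Set α)) '' (𝒜 : Set (Finset α)))
    (image_coe_subset_cellMembers h𝒜)
  rw [levelSlice_eq_image_shadowLevel hqu hup, ncard_image_coe, ncard_image_coe] at hL
  have hchoose : (0 : ℚ) < ((p + q).choose p : ℚ) := by
    exact_mod_cast Nat.choose_pos (by omega)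
  have hsym : ((p + q).choose q : ℚ) = ((p + q).choose p : ℚ) := by
    exact_mod_cast (Nat.choose_symm_add (a := p) (b := q)).symm
  rw [div_mul_eq_mul_div, div_le_iff₀ hchoose]
  rw [hsym] at hL
  linarith

/-- **Night-2's `ShadowC025Level` implies the level-wise form of night-1.** -/
theorem levelHallUp_of_shadowC025Level (h : ShadowC025Level) : LevelHallUpC025 := by
  intro α M _ p q u _ hqu hup 𝒜 h𝒜
  classical
  -- the finset family of the members of 𝒜
  set 𝒜f : Finset (Finset α) := (gr M).powerset.filter (fun B => (B : Set α) ∈ 𝒜) with h𝒜f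
  have h𝒜fU : 𝒜f ⊆ Uq M p q := by
    intro B hB
    rw [h𝒜f, Finset.mem_filter, Finset.mem_powerset] at hB
    exact mem_Uq_of_coe_mem_cellMembers hB.1 (h𝒜 hB.2)
  have himage : (fun B : Finset α => (B : Set α)) '' (𝒜f : Set (Finset α)) = 𝒜 := by
    ext Z
    constructor
    · rintro ⟨B, hB, rfl⟩
      rw [Finset.mem_coe, h𝒜f, Finset.mem_filter] at hB
      exact hB.2
    · intro hZ
      have hZE : Z ⊆ M.E := (h𝒜 hZ).1
      have hZfin : Z.Finite := M.ground_finite.subset hZE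
      refine ⟨hZfin.toFinset, ?_, hZfin.coe_toFinset⟩
      rw [Finset.mem_coe, h𝒜f, Finset.mem_filter, Finset.mem_powerset, hZfin.coe_toFinset]
      refine ⟨?_, hZ⟩
      intro x hx
      rw [hZfin.mem_toFinset] at hx
      rw [← Finset.mem_coe, coe_gr M]
      exact hZE hx
  have hS := h M p q u hqu hup 𝒜f h𝒜fU
  have hslice := levelSlice_eq_image_shadowLevel (M := M) hqu hup 𝒜f
  rw [himage] at hslice
  rw [hslice, ncard_image_coe, ← himage, ncard_image_coe]
  have hchoose : (0 : ℚ) < ((p + q).choose p : ℚ) := by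
    exact_mod_cast Nat.choose_pos (by omega)
  have hsym : ((p + q).choose q : ℚ) = ((p + q).choose p : ℚ) := by
    exact_mod_cast (Nat.choose_symm_add (a := p) (b := q)).symm
  rw [div_mul_eq_mul_div, div_le_iff₀ hchoose] at hS
  rw [hsym]
  linarith

/-- **ONE STATEMENT OF RECORD**: the level-wise form of C-044 UP (night-1) is night-2's `ShadowC025Level`. -/
theorem levelHallUp_iff_shadowC025Level : LevelHallUpC025 ↔ ShadowC025Level :=
  ⟨shadowC025Level_of_levelHallUp, levelHallUp_of_shadowC025Level⟩

/-- **THE FIRST LEVEL AT THE TIGHT LAYER, IN NIGHT-2'S VOCABULARY**: for every finite matroid with `#gr M = p + q`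
and `q + 2 ≤ p`, `ShadowHallLevel M p q (q+1) (C(p+q,q+1)/C(p+q,p))` — every sub-family `𝒜` of the bottom sets has at
least `C(p+q,q+1)/C(p+q,p)·#𝒜` rank-`(q+1)` sets above it (`levelHallUp_first_of_ncard_eq`). -/
theorem shadowHallLevel_first_of_card_eq (p q : ℕ) (hE : (gr M).card = p + q) (hpq : q + 2 ≤ p) :
    ShadowHallLevel M p q (q + 1) (((p + q).choose (q + 1) : ℚ) / ((p + q).choose p : ℚ)) := by
  intro 𝒜 h𝒜
  have hE' : M.E.ncard = p + q := by
    rw [← coe_gr M, Set.ncard_coe_finset, hE]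
  have hL := levelHallUp_first_of_ncard_eq M p q hE' hpq
    ((fun B : Finset α => (B : Set α)) '' (𝒜 : Set (Finset α))) (image_coe_subset_cellMembers h𝒜)
  rw [levelSlice_eq_image_shadowLevel (by omega) (by omega), ncard_image_coe, ncard_image_coe] at hL
  have hchoose : (0 : ℚ) < ((p + q).choose p : ℚ) := by
    exact_mod_cast Nat.choose_pos (by omega)
  have hsym : ((p + q).choose q : ℚ) = ((p + q).choose p : ℚ) := by
    exact_mod_cast (Nat.choose_symm_add (a := p) (b := q)).symm
  rw [div_mul_eq_mul_div, div_le_iff₀ hchoose]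
  rw [hsym] at hL
  linarith

end PercRepro
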